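import Summits.BirchSwinnertonDyer.BirchSwinnertonDyer.Theorems.ByReductionTypeAtTwoRankOneAtTwoOneDoorLawFirstLayerDefs
import Summits.BirchSwinnertonDyer.Rank1Residual.F1Sign2.JochnowitzSecondDigitAtTwo
import Literature.NumberTheory.EllipticCurves.BipartiteToricPeriod
import Literature.NumberTheory.EllipticCurves.Selmer
import HarnessLib.Audit.Tags
import HarnessLib

/-!
# Cell `bsd-f1-sign2` — Euler-system lens (planner `-es` g23; MEMO-es §32, CensusES32.md f47851bb8497, crux idea `selmer-atkin-lehner-floor-at-two`): ES-32 — THE 2-ADIC RIBET–TAKAHASHI /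
# POLLACK–WESTON COMPARISON ON THE DEFINITE QUATERNION ALGEBRA (ES-32A `TamagawaExponentIdentity`, ES-32A′ `BrandtIndexOddAtTwo`: SUPPORT, print-combination) AND THE WATKINS–DUMMIGAN
# 2-SELMER BOUND WITH ITS ATKIN–LEHNER FLOOR (ES-32B `WatkinsSelmerBoundAtTwo`, `WatkinsSelmerBoundOnSlice`, ES-32B♯ `SelmerAtkinLehnerFloorAtTwo`, `ALMinimalDegreeSelmerTrivialOnSlice`:
# `@[conjecture]`); carriers `unitWeight`, `IsClassSet`, `grossSelfPairing`, `classGcd`, `IsPrimitiveOn`, `twoAdicFloorAtTwo`, `oddPrimeCount`; -es's glue `alMinimal_of_floor` + REF1 §235's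
# kernel certificates live in the sibling `TamagawaExponentAtTwoKernel.lean` (frame = the ES-31 port `JochnowitzSecondDigitAtTwo.lean`'s `DefiniteFrame`); v2 = v1 p740775 + REF1 §237/§240
# and REF2 v58-add1 §B folds (docstring-only; every declaration byte-identical)

STATEMENTS ONLY (typer -ty g20).  Source: -es g23's crux workfile `Summits/BirchSwinnertonDyer/BirchSwinnertonDyer/Cruxes/RankOneAtTwoBigImageOddLocal/TamagawaExponentES32.lean` **b7bd048e5c2107df**
(238 l.; = `HOME/data-es/g23/lean32/Sketch32.lean`; line-identical to the REF1-audited text ac35c020b349d6f0 inlined in `REF1-data/b235/Probe235.lean` 04519f280d105f5b — builder-checked),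
lines 27–235 VERBATIM in -es's namespace `…Theorems.RankOneAtTwoTamagawaExponent` EXCEPT: (i) the ES-31 frame block (l.41–96: `twoDivCubic`, `NontrivialAtTwo`, `DefiniteFrame`, copied there
because the crux workfile `JochnowitzSecondDigitES31.lean` is not importable) is NOT re-declared (REF1 §235 A1 / R205a(ii) precedent: `dedup.fqn-exists`) — `DefiniteFrame` is IMPORTED from
the landed ES-31 port `F1Sign2/JochnowitzSecondDigitAtTwo.lean` (namespace `…Theorems.RankOneAtTwoJochnowitz`, byte-identical body, itself opening `twoDivCubic`/`NontrivialAtTwo` from the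
ES-28 port `F1Sign2/LevelRaisingAtTwo.lean`) and opened by name, so ES-31 and ES-32 speak about the same frame; (ii) -es's glue theorem `alMinimal_of_floor` is carried VERBATIM in the kernel
sibling; (iii) «RIDER» paragraphs appended to the docstrings; this header.  New bib key `EsparzaLozanoPasten2021` (PAMS 149 (2021), doi 10.1090/proc/15376, arXiv 2102.04185; -es's
locator «remark after Cor. 1.3 (Selmer form)» VERIFIED on the held text p. 3: «our argument actually shows that v₂(m_{E^{(D)}}) bounds the 2-Selmer rank, which is a stronger version of
Watkins' conjecture»).
PORT GATE = REF1-AUDIT §235 (-ref1 g21, 2026-08-29T19:09:56Z; Probe235.lean 04519f280d105f5b → check235.json 7e00a7662aba22cf rc 0, 6 sorries = the six A1 probes, BC7 a–c sorry-free;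
Probe235b 62f2d102607cd909 `oddPrimeCount 26 = 1` rc 0): **ALL SIX SURVIVE, 0 KILLED** — ES-32A/A′ print-combination SUPPORT rows (placement = REF2's desk), ES-32B/B♯ and the two slice
forms honest `@[conjecture]`s with a 38 042-curve census and correct polarity; riders R235a (32A′ hypothesis strength: `¬CM ∧ ∀ n, surjective mod 2ⁿ` is STRONGER than the Eisenstein-`Φ_q`
mechanism needs — irreducible / surjective mod 2 should do; not a defect) and R235b (the dip `c(2) = 0 < c(1) = 1` of `twoAdicFloorAtTwo` is an empirical fit — a mechanism is owed before
B♯ is called more than a census law).  A2 (reading ✓): `unitWeight J = #{β ∈ Bˣ : βJ = J}/2 = #O_l(J)ˣ/2` (finite for definite `B`, `≥ 1`), `IsClassSet` = unique left-`Bˣ` representative,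
`grossSelfPairing = Σ φ(J)²/w_J ∈ ℚ` (junk `/0` only off-frame), `classGcd` = Brandt index, `IsPrimitiveOn` = gcd of values 1; 32A homogeneous of degree 2 in `φ` (so `IsPrimitiveOn` is
unnecessary there, harmless) and NECESSARY in 32A′ (present ✓); `[W₀.IsGloballyMinimal]` makes `padicValRat q W₀.Δ = e_q` the Tamagawa EXPONENT; `ModularParametrizationData.deg_pos` ⇒ no
degree-0 junk; the optimality clause quantifies over ALL data with the same newform; `Nat.card (W.toAffine.Point[(2:ℤ)])` counts the identity (= dim form).  A3/A4: all four conjectures are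
∀-statements over genuine tree structures, not junk-provable, not junk-refutable; BC7-b `slice_of_bound` (B ∧ `#W(ℚ)[2] = 1` ⟹ slice inequality: the slice row's hypotheses only discharge «no
rational 2-torsion»), BC7-c `bound_of_floor` (B♯ ∧ `1 ≤ ω_odd + c` ⟹ B; the excluded case `N ∈ {1, 4}` has no curves ⇒ **B♯ ⟹ B on curves without 2-torsion**, consistent strength
ordering), -es's `alMinimal_of_floor` (AL-slice row = corollary of B♯ given `#W(ℚ)[2] = 1`).  REF1 g22 §237 (19:22Z): PORT CHECK of
the crux workfile b7bd… vs the §235-audited text BYTE-IDENTICAL (portcheck 17/17 IDENTICAL) ⇒ §235 verdicts transfer verbatim («workfile ns is already `…RankOneAtTwoTamagawaExponent` —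
move, don't copy; import the ES-31 frame» = this port).  REF1 g22 §240 (19:31Z): BC7 RE-RUN of the rows on the FULL definite census (j334937 + j334662) REPRODUCED with an
independent script — (A) 2 416/2 416; frame 1 463; `I_D` odd 1 463/1 463; definite floor law 1 463/1 463 (tight 506); `I_D ∣ #tors` 2 416/2 416, `I_D ∣ c_q` 2 412/2 416; MUTATION:
dropping B♯'s `E(ℚ)[2] = 0` is REFUTED in-sample on 180/695 reducible optimal curves (14a1: 2 > 0; 17a1: 1 > 0) ⇒ that hypothesis is LOAD-BEARING for B♯, whereas for 32A′ the
census law is `v₂(I_D) ≤ dim E(ℚ)[2]` (R235a sharpened: «`E(ℚ)[2] = 0` suffices»); R235b downgraded to «mechanism named (`ε₂ = −1` at `4 ∥ N`, REF2 §B), residue `⌈v/2⌉` proof owed».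
REF2 PLACEMENT (REF2-PLACEMENT-v58-add1 §B 58851909ba65edab, 19:19Z; v2 fold).  B.1 PRINT LAYER under B♯ (a theorem, not a conjecture) — **R58f**: `E` optimal,
`E(ℚ)[2] = 0` ⟹ `v₂(deg π_E) ≥ el(E) := ω(N) − 1 + [ε_p = +1 for every p ∣ N]` [cite: CalegariEmerton2009, §2 (proof of Thm. 8) and Lemma 9] (the Atkin–Lehner group `W ≅ (ℤ/2)^{ω(N)}`
acts on the optimal quotient; with `E(ℚ)[2] = 0` its image in `Aut E` has order ≤ 2, so `π` factors through `X₀(N)/W₀`, `|W₀| ≥ 2^{ω(N)−1}`; mechanism named in print by Watkins 2002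
and for abelian varieties [cite: DummiganKrishnamoorthy2013]); CENSUS of R58f on -es's rows (`t₂ = 0`, `N ≤ 10⁴`): 0/25 195 violations, tight 1 699; all 48 odd-degree optimal curves
with `t₂ = 0` have PRIME conductor (C–E Thm 1).  B.2 WHAT B♯ SAYS BEYOND R58f: with `x(E) := v₂(deg) − el(E) ≥ 0` and `inc(E) := s₂ − [ε ≡ +1]`, B♯ ⟺ `x(E) ≥ inc(E) + g(v₂N)`,
`g = (0, 0, −1, 1, 1, 2, 2, 3, 3)` for `v₂N = 0…8` (`g(v) = c(v) − [v ≥ 1]`); measured minima of `x` by `(v₂N, inc)` registered in v58-add1 (at `v₂N ≤ 1` the Selmer increment is EXACTLY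
ADDITIVE over the printed floor, tight 1 173 + 1 766; at `4 ∥ N` — where `ε₂ = −1` ALWAYS, 3 226/3 226, a local root-number fact — one Selmer 2 is ABSORBED: the 150 «violations» of
the naive count = R235b's dip, consistent with [cite: AgasheRibetStein2012, Thm. 2.1 and Thm. 3.6(b)] (deg may drop below the congruence number exactly when `p² ∣ N`); for `v₂N ≥ 3`
the residue rides on a 2-adic growth `g(v) ≈ ⌈v/2⌉ − 1`).  The LITERAL additive Watkins–Dummigan reading «`2^{#Sel₂}·#(AL subgroup) ∣ deg`» is FALSE in-sample 599/25 195 (43a1: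
rank 1, `ε₄₃ = +1`, deg 2) — B♯'s «−1»/«−[ε ≡ +1]» is exactly the correction.  B.3 VERDICTS: (A) `TamagawaExponentIdentity`, `BrandtIndexOddAtTwo`: PRINT (Conrad–Stein 2001 Thm 6.1
+ 8.2; Ribet 1990 Thm 3.12 / Edixhoven via ARS) — Literature facts, statement-only ports (D-es-93), concur «SUPPORT»; `WatkinsSelmerBoundAtTwo` (P32.6): CONJECTURED IN PRINT informally
and without the `t₂`-slack (Watkins via [cite: Dummigan2006, §1] «the order of the 2-Selmer group should divide the modular degree»; [cite: EsparzaLozanoPasten2021, remark after Cor. 1.3],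
proved for their family), partial theorems Dummigan 2006 Prop 5.4, C–E 2009 Thm 1, Kazalicki–Kohen, Caro–Pasten 2022, Caro 2025 — statement = print (informal), EVIDENCE at a scale
not in print; `SelmerAtkinLehnerFloorAtTwo` (B♯) = R58f (PRINT theorem) + the residue «`x ≥ inc + g(v₂N)`», residue NOT IN PRINT (corpus/galaxy/page reads) — GRADE NEW-COMBINATION,
beyond-print theorem NO (conjecture + census), cheapest external falsifier: one optimal curve with `t₂ = 0`, `10⁴ < N ≤ 5·10⁵`, `x < inc + g` (D-es-92; register the per-(v, inc) minima
first, report R58f separately as checksum); `ALMinimalDegreeSelmerTrivialOnSlice`: corollary of B♯, conjecture-grade, not in print (the slice × floor coincidence is the cell's); asks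
back E32-R1 (re-register B♯ in the excess form), E32-R2′ (on the 150 dip curves confirm `v₂(r_E) = v₂(deg) + 1` with Sage's congruence number).

ROWS.  **ES-32A** `TamagawaExponentIdentity` (PLAIN SUPPORT): on the frame, for the `X₀(qN_W)`-optimal `W₀` of the class of `W'`, `deg(D₀)·I_φ² = v_q(Δ_{W₀})·⟨φ,φ⟩` [cite: ConradStein2001, Thm. 6.1 and Thm. 8.2]
[cite: Ribet1990, Thm. 3.12].  **ES-32A′** `BrandtIndexOddAtTwo` (PLAIN SUPPORT; R235a): the Brandt index of a level-raised curve of the crux's `W` is ODD ⟹ with 32A `v₂(deg D₀) = v₂⟨φ,φ⟩ +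
v₂(v_qΔ_{W₀})`, the `p = 2` Pollack–Weston Tamagawa-exponent formula by citation.  **ES-32B** `WatkinsSelmerBoundAtTwo` (`@[conjecture]` = Watkins' Conj. 4.1 in 2-Selmer form, known-open):
`#Sel₂(W) ≤ 2^{v₂ deg D}·#W(ℚ)[2]` for optimal `D`.  **ES-32B-slice** `WatkinsSelmerBoundOnSlice` (`@[conjecture]`; corollary of B given no 2-torsion).  **ES-32B♯** `SelmerAtkinLehnerFloorAtTwo`
(`@[conjecture]`, THE LAW of the lens, beyond print as a precise law; R235b): for optimal `W` with `#W(ℚ)[2] = 1`, `#Sel₂·2^{ω_odd(N) + c(v₂N)} ≤ 2·2^{v₂ deg}`.  **AL-slice**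
`ALMinimalDegreeSelmerTrivialOnSlice` (`@[conjecture]`; corollary of B♯): AL-minimal degree on the crux's slice ⟹ `#Sel₂(W) ≤ 2` (⟹ with rank 1: `Sel₂ = ℤ/2`, `Ш(W)[2^∞] = 0` — the ALGEBRAIC
half of `BSD₂(W)` on that sub-slice; correctly NOT claimed to close 23715).
DATA = BC5 WITNESS (-es MEMO-es §32 / CensusES32.md f47851bb8497 / STATUS 2026-08-29T19:08Z + 19:24Z; numbers not adjectives): ENGINE 32 (definite Brandt side; kit j334478/j334618/j334662,
remainder j334937 merged): Tamagawa-exponent identity **2 416 / 2 416** `(E, q)` pairs (`v₂(M) = 0..8` all; `4 ∣ N` 536/536; `9 ∣ N` 187/187), `φ`-form 2 416/2 416; on the crux's frame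
(`E[2]` irreducible) `v₂(deg) = v₂⟨φ,φ⟩_w + v₂(e_q)` **1 463 / 1 463** (32A′: `v₂(I) = 0` in 100 % of pairs with `E[2]` irreducible).  ENGINE 32S (2-descent × modular degree; kit j334662,
`N ≤ 10⁴`, 38 042 optimal curves): B 38 042/38 042; B♯ 25 195/25 195 (`E(ℚ)[2] = 0`), EQUALITY 3 438 (46 with `Ш[2] ≅ (ℤ/2)²`), the uncorrected `ω(N) − 1` failing exactly at `v₂(N) = 2`
(150 curves); slice 1 435/1 435 (AL-minimal, `Sel₂ = ℤ/2`).  OUT OF SAMPLE (kit j334983, all 437 226 optimal curves `N ≤ 10⁵`, 2-descended): B 437 226/437 226; B♯ 313 185/313 185, tight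
23 084 (911 with `Ш`); slice 32 637 rows, AL-minimal 9 613/9 613 `Sel₂ = ℤ/2` (60 slice curves off the floor have `Ш[2] ≅ (ℤ/2)²`); rank-1 `W[2]`-irreducible 13 415/13 415, AL-minimal
2 160/2 160; rank-0 analogues 842/842 resp. 4 677/4 677.  REF1 ran no numerics (A5).  CHEAPEST FALSIFIERS (REF1 §235 A5): (B) a rank-0 optimal curve with ODD modular degree and `Ш[2] ≠ 0`
(LMFDB: degree odd, `Ш` divisible by 4; Watkins–Dummigan folklore: none known; Calegari–Emerton constrain odd degree); (B♯) curves with `Ш[2] ≅ (ℤ/2)⁴` at `N > 10⁴` (LMFDB has them — one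
query settles many rows); (32A exactness at `p = 2`) any `(E, q)` with `4 ∣ N` beyond the census.
PARTITION: none moved (B/B♯ conjecture-grade — B = print conjecture restated, B♯ new precise form, REF2 to place; 32A/A′ print-support).  Beyond-print theorem: no.  BSD is not proved by
this; 23715 is not closed.  bears_on: stmt-BirchSwinnertonDyer-23715 (crux `RankOneAtTwoBigImageOddLocal`; the «period comparison at 2» of the jochnowitz_two / one_door lines).
-/

open scoped Classical BigOperators AddSubgroup

noncomputable section

set_option linter.dupNamespace false
set_option autoImplicit false

namespace Summit.BirchSwinnertonDyer.BirchSwinnertonDyer.Theorems.RankOneAtTwoTamagawaExponent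

open Literature.NumberTheory.EllipticCurves Literature.NumberTheory.EllipticCurves.ModularForms
  Summit.BirchSwinnertonDyer.Rank1Residual.F1Sign2
  Summit.BirchSwinnertonDyer.BirchSwinnertonDyer.Theorems.RankOneAtTwoOneDoor
  WeierstrassCurve
open Summit.BirchSwinnertonDyer.BirchSwinnertonDyer.Theorems.RankOneAtTwoJochnowitz (DefiniteFrame)

/-! ### ES-32 vocabulary (the ES-31 frame `DefiniteFrame W W' q a b O RI φ` is imported from `F1Sign2/JochnowitzSecondDigitAtTwo.lean` and opened by name) -/

variable {a b : ℚ}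

/-- Eichler's unit weight `w_J = ½ #{β ∈ B× : βJ = J}` (`= #O_l(J)^×/2`; finite since `B` is definite). -/
noncomputable def unitWeight (J : Submodule ℤ (QuaternionAlgebra ℚ a 0 b)) : ℕ :=
  Nat.card {β : QuaternionAlgebra ℚ a 0 b // IsUnit β ∧ J.map (AddMonoidHom.mulLeft β).toIntLinearMap = J} / 2

/-- `S` is a complete set of representatives of the left-`B×`-classes of `RI`. -/
def IsClassSet (RI : Set (Submodule ℤ (QuaternionAlgebra ℚ a 0 b))) (S : Finset (Submodule ℤ (QuaternionAlgebra ℚ a 0 b))) : Prop :=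
  (↑S ⊆ RI) ∧ ∀ J ∈ RI, ∃! J₀, J₀ ∈ S ∧ ∃ β : QuaternionAlgebra ℚ a 0 b, IsUnit β ∧ J = J₀.map (AddMonoidHom.mulLeft β).toIntLinearMap

/-- The Gross/Petersson self-pairing `⟨φ, φ⟩ = Σ_{J ∈ S} φ(J)² / w_J` (functions normalisation; ENGINE 32's `ppF`).
(RIDER, typer -ty g20: REF1-AUDIT §235 A2 ✓ — division by `w_J = unitWeight J ≠ 0` on the frame (`unitWeight ≥ 1` since `±1` stabilise `J`; finite for definite `B`); the junk
value `/0` can only occur off-frame.  Functions normalisation (ENGINE 32's `ppF`); R205e (ES-31 port): parities are normalisation-sensitive when some `w_i` is even — 32A is stated in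
this normalisation throughout.) -/
noncomputable def grossSelfPairing (φ : Submodule ℤ (QuaternionAlgebra ℚ a 0 b) → ℤ)
    (S : Finset (Submodule ℤ (QuaternionAlgebra ℚ a 0 b))) : ℚ :=
  ∑ J ∈ S, ((φ J : ℚ) ^ 2) / (unitWeight J : ℚ)

/-- The BRANDT INDEX `I_φ = gcd_{J, J' ∈ S} (φ J − φ J')` (ENGINE 32's `GF`). -/
def classGcd (φ : Submodule ℤ (QuaternionAlgebra ℚ a 0 b) → ℤ) (S : Finset (Submodule ℤ (QuaternionAlgebra ℚ a 0 b))) : ℕ :=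
  S.gcd fun J => S.gcd fun J' => (φ J - φ J').natAbs

/-- `φ` is primitive on `S`: `gcd_{J ∈ S} φ(J) = 1`. -/
def IsPrimitiveOn (φ : Submodule ℤ (QuaternionAlgebra ℚ a 0 b) → ℤ) (S : Finset (Submodule ℤ (QuaternionAlgebra ℚ a 0 b))) : Prop :=
  (S.gcd fun J => (φ J).natAbs) = 1

/-- **ES-32A `TamagawaExponentIdentity` — IN PRINT (Conrad–Stein 2001 Thm 6.1 + Thm 8.2, with Ribet 1990's identification of the character
group at `q` of `J₀(qN)` with `ℤ[S]⁰`; Pollack–Weston's «Tamagawa exponent» at `N⁻ = q`).**  On the frame, for the `X₀(qN_W)`-OPTIMAL curve `W₀`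
of the isogeny class of `W'` with optimal parametrisation datum `D₀`:  `deg(D₀) · I_φ² = v_q(Δ_{W₀}) · ⟨φ, φ⟩`.  ENGINE 32 (j334478, j334618,
j334662): identity holds in 100 % of the computed `(E, q)` pairs.  Filed as SUPPORT (a Literature port ask), not as a conjecture.
[cite: ConradStein2001, Thm. 6.1 and Thm. 8.2] [cite: Ribet1990, Prop. 3.1–3.3 and Thm. 3.12 (shape)] [cite: PollackWeston2011, Prop. (prop:char) (p ≥ 5 analogue)]
(RIDER, typer -ty g20: PLAIN SUPPORT (print-combination; a Literature port ask, not a conjecture).  REF1-AUDIT §235: **SURVIVES** — `IsIsogenous W₀ W'` + minimal degree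
among data with the same newform = the `X₀(qN)`-optimal curve ✓; `[W₀.IsGloballyMinimal]` makes `padicValRat q W₀.Δ = e_q` the Tamagawa EXPONENT (`= v_q(Δ_min)`, split or not) ✓;
`ModularParametrizationData.deg_pos` ⇒ no degree-0 junk ✓; the identity is HOMOGENEOUS of degree 2 in `φ` (`I_φ²` and `⟨φ,φ⟩` both scale by `λ²`), so `IsPrimitiveOn` is unnecessary
here (harmless).  BC5 (-es ENGINE 32, full definite census j334937 merged, MEMO-es §32.9): **2 416 / 2 416** `(E, q)` pairs incl. `4 ∣ N` 536/536, `9 ∣ N` 187/187; `φ`-form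
2 416/2 416.  REF1 §240: REPRODUCED on the full census with an independent script (2 416/2 416; definite floor law 1 463/1 463, tight 506).  REF2 v58-add1 §B: PRINT — a Literature fact,
statement-only port (D-es-93); the reading «`v₂(deg) = v₂⟨φ,φ⟩_w + v₂(e_q)` on the `E[2]`-irreducible frame» is a corollary of print and retires REF2's E31-R0 query.) -/
def TamagawaExponentIdentity : Prop :=
  ∀ (W : WeierstrassCurve ℚ) [W.IsElliptic] [W.IsGloballyMinimal] [NeZero (W.conductorNorm ℤ)]
    (W' : WeierstrassCurve ℚ) [W'.IsElliptic] [W'.IsGloballyMinimal] (q : ℕ) [Fact q.Prime]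
    (a b : ℚ) (O : Subring (QuaternionAlgebra ℚ a 0 b)) (RI : Set (Submodule ℤ (QuaternionAlgebra ℚ a 0 b)))
    (φ : Submodule ℤ (QuaternionAlgebra ℚ a 0 b) → ℤ), DefiniteFrame W W' q a b O RI φ →
    ∀ S : Finset (Submodule ℤ (QuaternionAlgebra ℚ a 0 b)), IsClassSet RI S → IsPrimitiveOn φ S →
    ∀ (W₀ : WeierstrassCurve ℚ) [W₀.IsElliptic] [W₀.IsGloballyMinimal] (D₀ : ModularParametrizationData W₀ (q * W.conductorNorm ℤ)),
      WeierstrassCurve.IsIsogenous W₀ W' →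
      (∀ (W'' : WeierstrassCurve ℚ) [W''.IsElliptic] (D'' : ModularParametrizationData W'' (q * W.conductorNorm ℤ)),
        D''.f = D₀.f → D₀.modularDegree ≤ D''.modularDegree) →
      (D₀.modularDegree : ℚ) * (classGcd φ S : ℚ) ^ 2 = (padicValRat q W₀.Δ : ℚ) * grossSelfPairing φ S

/-- **ES-32A′ `BrandtIndexOddAtTwo` — IN PRINT (Ribet 1990 Thm 3.12 / Edixhoven 1991: `Φ_q(J₀(qN))` is Eisenstein, so `ℓ ∣ I_φ ⟹ ρ̄_{E,ℓ}`
reducible; on the frame `ρ̄_{W',2} ≅ ρ̄_{W,2}` is irreducible).**  The Brandt index of a level-raised curve of the crux's `W` is ODD; with ES-32A: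
`v₂(deg D₀) = v₂⟨φ,φ⟩ + v₂(v_q Δ_{W₀})` — the `p = 2` Pollack–Weston Tamagawa-exponent formula, by citation.  ENGINE 32: `v₂(I) = 0` in 100 % of
pairs with `E[2]` irreducible.  SUPPORT. [cite: Ribet1990, Thm. 3.12] [cite: Edixhoven1991, §4 (Eisenstein action on Φ)]
(RIDER, typer -ty g20: PLAIN SUPPORT.  REF1-AUDIT §235: **SURVIVES with R235a** — the hypotheses `¬ W.HasCM ∧ ∀ n, surjective mod 2ⁿ` are STRONGER than the mechanism needs
(Ribet 3.12 / Eisenstein `Φ_q`: `ρ̄_{W,2}` irreducible suffices; «`W.HasSurjectiveModNGaloisRep 2` should do») — not a defect, recorded for the consumer; `IsPrimitiveOn φ S` is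
NECESSARY here (oddness of `I_φ`) and present ✓.  BC5: ENGINE 32 `v₂(I) = 0` in 100 % of pairs with `E[2]` irreducible; on the crux's frame `v₂(deg) = v₂⟨φ,φ⟩_w + v₂(e_q)`
**1 463 / 1 463** (MEMO-es §32.9; REF1 §240 re-run: `I_D` odd 1 463/1 463, `I_D ∣ #tors` 2 416/2 416, `I_D ∣ c_q` 2 412/2 416).  REF1 §240 R235a SHARPENED: the census law is
`v₂(I_D) ≤ dim E(ℚ)[2]`, so «`E(ℚ)[2] = 0`» suffices here.  REF2 v58-add1 §B: PRINT (Ribet 1990 Thm 3.12 / Edixhoven 1991 via [cite: AgasheRibetStein2012, §2]) — Literature fact,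
statement-only port (D-es-93).) -/
def BrandtIndexOddAtTwo : Prop :=
  ∀ (W : WeierstrassCurve ℚ) [W.IsElliptic] [W.IsGloballyMinimal] [NeZero (W.conductorNorm ℤ)]
    (W' : WeierstrassCurve ℚ) [W'.IsElliptic] [W'.IsGloballyMinimal] (q : ℕ) [Fact q.Prime],
    ¬ W.HasCM → (∀ n : ℕ, W.HasSurjectiveModNGaloisRep ((2 ^ n : ℕ) : ℤ)) →
    ∀ (a b : ℚ) (O : Subring (QuaternionAlgebra ℚ a 0 b)) (RI : Set (Submodule ℤ (QuaternionAlgebra ℚ a 0 b)))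
      (φ : Submodule ℤ (QuaternionAlgebra ℚ a 0 b) → ℤ), DefiniteFrame W W' q a b O RI φ →
    ∀ S : Finset (Submodule ℤ (QuaternionAlgebra ℚ a 0 b)), IsClassSet RI S → IsPrimitiveOn φ S → Odd (classGcd φ S)

/-- **ES-32B `WatkinsSelmerBoundAtTwo` — THE CANDIDATE (conjecture of this lens; Watkins' modular-degree conjecture in its `2`-SELMER form,
stated on the tree).**  For every elliptic curve over `ℚ` given by a globally minimal `W` and every OPTIMAL parametrisation datum `D` at level
`N_W` (minimal degree among data with the same newform = the `X₀(N)`-optimal curve of the class):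
`#Sel₂(W) ≤ 2^{v₂(deg D)} · #W(ℚ)[2]`, i.e. `dim_{𝔽₂} Sel₂(W) − dim_{𝔽₂} W(ℚ)[2] ≤ v₂(modular degree)`.
For the crux's `W` (rank `1`, `W[2]` irreducible): `dim_{𝔽₂} Ш(W)[2] ≤ v₂(deg) − 1`; with ES-32A/A′ at any level-raising / multiplicative
prime: `dim Ш(W₀)[2] ≤ v₂⟨φ,φ⟩ + v₂(e_q) − 1` — a DESCENT-FREE bound for `Ш[2]` by the `2`-adic valuation of the Gross self-pairing.
Why it might fail: a rank-`0` curve with odd modular degree and `Ш[2] ≠ 0` (none with `N ≤ 10⁴`: ENGINE 32S census), or high `2`-rank `Ш` at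
a level where the Hecke algebra is `2`-adically Gorenstein-defective (Kilford primes `431, 503, 2089`).  Known: `2^r ∣ deg` is Watkins'
Conjecture 4.1 (open; Dummigan: ⟸ an `R = T` theorem at `2`); odd degree ⟹ rank `0` and `N` has ≤ 2 odd prime factors (Calegari–Emerton).
Census ENGINE 32S j334662 (`38 042` optimal curves, `N ≤ 10⁴`): see MEMO-es §32. [cite: Watkins2002, Conj. 4.1] [cite: Dummigan2006, §1 and Prop. 4.2]
[cite: CalegariEmerton2009, Thm. 1.1]
(RIDER, typer -ty g20: `@[conjecture]` — Watkins' Conj. 4.1 in its 2-SELMER form (known-open; the Selmer form is in print as a remark for the twists treated in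
[cite: EsparzaLozanoPasten2021, remark after Cor. 1.3] — «v₂(m_{E^{(D)}}) bounds the 2-Selmer rank, a stronger version of Watkins' conjecture», verified on the held text).  REF1-AUDIT
§235: **SURVIVES** — `Nat.card (W.toAffine.Point[(2:ℤ)])` = `#E(ℚ)[2]` INCLUDING the identity (1, 2 or 4) ✓ = «dim Sel₂ − dim E[2] ≤ v₂(deg)»; the optimality hypothesis makes the row
vacuous on non-optimal models ✓ intended; paper rows: 11a1 (`#Sel₂ = 1`, deg 1) `1 ≤ 1`, 37a1 (`#Sel₂ = 2`, deg 2) `2 ≤ 2` tight, 389a1 (`4`, deg 40) ✓, 5077a1 (`8`, deg 1984 = 2⁶·31) ✓.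
BC5: ENGINE 32S j334662 38 042/38 042 (`N ≤ 10⁴`), OUT OF SAMPLE j334983 437 226/437 226 (`N ≤ 10⁵`).  CHEAPEST FALSIFIER (REF1): a rank-0 optimal curve with ODD modular degree
and `Ш[2] ≠ 0` (LMFDB query «degree odd, Ш divisible by 4»).  REF2 v58-add1 §B (= P32.6): CONJECTURED IN PRINT informally and without the `t₂`-slack — Watkins via
[cite: Dummigan2006, §1] «the order of the 2-Selmer group should divide the modular degree (as opposed to just 2^R dividing it)»; partial theorems in print: Dummigan 2006 Prop 5.4
(`R_∅ ≅ T_∅` c.i. ⟹ `2^R ∣ deg`), [cite: CalegariEmerton2009, Thm. 1] (layer 0), Kazalicki–Kohen (odd congruence number ⟹ rank 0), Caro–Pasten 2022, Caro 2025; statement =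
print (informal), the typed `t₂`-slack form and the census are -es's EVIDENCE at a scale not in print.) -/
@[conjecture] def WatkinsSelmerBoundAtTwo : Prop :=
  ∀ (W : WeierstrassCurve ℚ) [W.IsElliptic] [W.IsGloballyMinimal] [NeZero (W.conductorNorm ℤ)]
    (D : ModularParametrizationData W (W.conductorNorm ℤ)),
    (∀ (W'' : WeierstrassCurve ℚ) [W''.IsElliptic] (D'' : ModularParametrizationData W'' (W.conductorNorm ℤ)),
        D''.f = D.f → D.modularDegree ≤ D''.modularDegree) →
    Nat.card (W.selmerGroup 2) ≤ 2 ^ (padicValNat 2 D.modularDegree) * Nat.card (W.toAffine.Point[(2 : ℤ)])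

/-- **ES-32B on the slice of the crux** (rank one, big image at `2`): `2 · #Ш`-free form — `#Sel₂(W) ≤ 2^{v₂(deg D)}` and hence, since
`Sel₂ ⊇ W(ℚ)/2 ≅ 𝔽₂`, `#Ш(W)[2] ≤ 2^{v₂(deg D) − 1}`.  Immediate from `WatkinsSelmerBoundAtTwo` (no `2`-torsion under surjective `ρ̄_{W,2}`).
(RIDER, typer -ty g20: `@[conjecture]` as sketched; REF1-AUDIT §235: **SURVIVES** as a COROLLARY of `WatkinsSelmerBoundAtTwo` given no rational 2-torsion — kernel BC7-b
`TamagawaExponent.Kernel.slice_of_bound : WatkinsSelmerBoundAtTwo → (#W(ℚ)[2] = 1) → slice inequality`, so the big-image / odd-torsion / Tamagawa / rank-1 hypotheses here serve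
only to discharge `#W(ℚ)[2] = 1` (surjective mod 2 ⇒ `W(ℚ)[2] = 0`).) -/
@[conjecture] def WatkinsSelmerBoundOnSlice : Prop :=
  ∀ (W : WeierstrassCurve ℚ) [W.IsElliptic] [W.IsGloballyMinimal] [NeZero (W.conductorNorm ℤ)],
    ¬ W.HasCM → (∀ n : ℕ, W.HasSurjectiveModNGaloisRep ((2 ^ n : ℕ) : ℤ)) → Odd W.torsionOrder → Odd W.tamagawaProduct →
    W.analyticRank = 1 →
    ∀ (D : ModularParametrizationData W (W.conductorNorm ℤ)),
    (∀ (W'' : WeierstrassCurve ℚ) [W''.IsElliptic] (D'' : ModularParametrizationData W'' (W.conductorNorm ℤ)),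
        D''.f = D.f → D.modularDegree ≤ D''.modularDegree) →
    Nat.card (W.selmerGroup 2) ≤ 2 ^ (padicValNat 2 D.modularDegree)

/-- The contribution of the prime `2` to the `2`-adic modular-degree floor, by conductor exponent `v = v₂(N)` (ENGINE 32S, curves with
`E(ℚ)[2] = 0`): `c(0) = 0`, `c(1) = 1` (the Atkin–Lehner involution `w₂`), `c(2) = 0` (sic), `c(v) = ⌈v/2⌉` for `v ≥ 3`; attained in
`1173 / 1766 / 150 / 155 / 77 / 59 / 24 / 30 / 4` curves for `v = 0, …, 8` (`N ≤ 10⁴`).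
(RIDER, typer -ty g20: REF1 §235 BC7-a (kernel sibling, `decide`): `c(0..8) = 0, 1, 0, 2, 2, 3, 3, 4, 4` = this docstring ✓.  **R235b**: the dip `c(2) = 0 < c(1) = 1` is an
EMPIRICAL fit («sic»; the uncorrected count fails exactly at `v₂(N) = 2`, 150 curves) — the rows below are typed with it, so they are honest, but a MECHANISM for the dip is owed
before B♯ is called more than a census law (the B♯ docstring says so: «hiding a second mechanism»).  REF1 §240 / REF2 v58-add1 §B.2–B.4: R235b DOWNGRADED to «mechanism named,
residue proof owed» — at `4 ∥ N` EVERY optimal curve has `ε₂ = −1` (`w₄ f = −f`, 3 226/3 226; local fact: conductor exponent 2 at 2 ⟹ tame potentially good, `W₂(E) = −1`), so `w₄`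
never enters the Atkin–Lehner floor and the first Selmer 2 can be absorbed there (150 curves, all with `x = inc − 1`; [cite: AgasheRibetStein2012, Thm. 2.1 and Thm. 3.6(b)]);
in REF2's excess form `g(v) = c(v) − [v ≥ 1] = (0, 0, −1, 1, 1, 2, 2, 3, 3)`; the growth `≈ ⌈v/2⌉ − 1` for `v ≥ 3` has no printed source (suspect: the twist-degree formula).) -/
def twoAdicFloorAtTwo (v : ℕ) : ℕ :=
  if v = 0 then 0 else if v = 1 then 1 else if v = 2 then 0 else (v + 1) / 2

/-- The number of ODD primes of bad reduction, `ω_odd(N) = #{p odd prime : p ∣ N}`.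
(RIDER, typer -ty g20: REF1 Probe235b (Mathlib-only check, kernel sibling `oddPrimeCount_twentySix`): `oddPrimeCount 26 = 1` via `Nat.primeFactors_mul`.) -/
def oddPrimeCount (N : ℕ) : ℕ := (N.primeFactors.filter (fun p => p ≠ 2)).card

/-- **ES-32B♯ `SelmerAtkinLehnerFloorAtTwo` — THE SHARP CANDIDATE (law of this lens; Watkins' «even stronger» Atkin–Lehner suggestion made
precise, with the `2`-adic step function `c`).**  For an optimal `E/ℚ` WITHOUT rational `2`-torsion:
`dim_{𝔽₂} Sel₂(E) + (ω_odd(N) − 1) + c(v₂(N)) ≤ v₂(deg π_E)`, i.e. `#Sel₂(E) · 2^{ω_odd(N) + c(v₂ N)} ≤ 2 · 2^{v₂(deg)}`.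
Census ENGINE 32S j334662: `25 195 / 25 195` optimal curves with `E(ℚ)[2] = 0`, `N ≤ 10⁴`; EQUALITY in `3 438` (so every term is
load-bearing), among them `46` curves with `Ш[2] ≅ (ℤ/2)²`; the uncorrected count `ω(N) − 1` fails exactly at `v₂(N) = 2` (`150` curves).  OUT OF SAMPLE (kit j334983, all `437 226` optimal curves `N ≤ 10⁵`): `313 185 / 313 185`, `23 084` equalities (`911` with Ш), minimum margin `0` in every `v₂(N)`-class; plain Selmer form `437 226 / 437 226`.
Reading: `v₂(deg) − [Atkin–Lehner/local floor] ≥ dim Sel₂` — the `2`-part of the congruence number left after the local (level) congruences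
bounds the `2`-Selmer rank (Dummigan's `R = T` heuristic, reversed into a BOUND).  Why it might fail: a curve with `Ш[2] ≅ (ℤ/2)⁴` at a level
whose `2`-adic Hecke algebra is Gorenstein-defective, or `v₂(N) = 2` hiding a second mechanism; beyond `N = 10⁴` untested. [cite: Dummigan2006, §1 (Watkins' Selmer and Atkin–Lehner refinements) and §5]
[cite: Watkins2002, Conj. 4.1–4.2] [cite: EsparzaLozanoPasten2021, remark after Cor. 1.3 (Selmer form)]
(RIDER, typer -ty g20: `@[conjecture]` — THE LAW of the -es lens.  REF2 v58-add1 §B PLACEMENT: B♯ = **R58f** (PRINT theorem: `E` optimal, `E(ℚ)[2] = 0` ⟹ `v₂(deg) ≥ ω(N) − 1 + [ε ≡ +1]`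
[cite: CalegariEmerton2009, §2 (proof of Thm. 8) and Lemma 9]; abelian-variety version [cite: DummiganKrishnamoorthy2013]; 0/25 195 violations, tight 1 699) + the RESIDUE «`x(E) ≥ inc(E) +
g(v₂N)`» (`x = v₂(deg) − el`, `inc = s₂ − [ε ≡ +1]`, `g = c − [v ≥ 1]`), residue NOT IN PRINT — GRADE **NEW-COMBINATION**, beyond-print theorem: no (conjecture + census); the
literal additive Watkins–Dummigan reading is FALSE in-sample 599× (43a1), B♯'s «−1» is exactly the correction.  REF1 §240 MUTATION: dropping `Nat.card (W.toAffine.Point[(2:ℤ)]) = 1` is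
REFUTED in-sample on 180/695 reducible optimal curves (14a1, 17a1) ⇒ the hypothesis is LOAD-BEARING.  REF1-AUDIT
§235: **SURVIVES with R235b** (the `c(2) = 0` dip is empirical); kernel BC7-c `TamagawaExponent.Kernel.bound_of_floor`: this ∧ `1 ≤ ω_odd + c` ⟹ `WatkinsSelmerBoundAtTwo`'s
inequality on curves with `#W(ℚ)[2] = 1` (the only excluded case `ω_odd = 0 ∧ c = 0` is `N ∈ {1, 4}`: no curves) ⇒ **B♯ ⟹ B on curves without 2-torsion**, consistent strength
ordering.  BC5 (-es ENGINE 32S): `N ≤ 10⁴` (j334662) 25 195/25 195, EQUALITY 3 438 (46 with `Ш[2] ≅ (ℤ/2)²`); OUT OF SAMPLE `N ≤ 10⁵` (j334983) 313 185/313 185, tight 23 084 (911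
with `Ш`).  CHEAPEST FALSIFIER (REF1): curves with `Ш[2] ≅ (ℤ/2)⁴` at `N > 10⁴` (LMFDB) — one query settles many rows; or `v₂(N) = 2` hiding a second mechanism.) -/
@[conjecture] def SelmerAtkinLehnerFloorAtTwo : Prop :=
  ∀ (W : WeierstrassCurve ℚ) [W.IsElliptic] [W.IsGloballyMinimal] [NeZero (W.conductorNorm ℤ)]
    (D : ModularParametrizationData W (W.conductorNorm ℤ)),
    (∀ (W'' : WeierstrassCurve ℚ) [W''.IsElliptic] (D'' : ModularParametrizationData W'' (W.conductorNorm ℤ)),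
        D''.f = D.f → D.modularDegree ≤ D''.modularDegree) →
    Nat.card (W.toAffine.Point[(2 : ℤ)]) = 1 →
    Nat.card (W.selmerGroup 2) * 2 ^ (oddPrimeCount (W.conductorNorm ℤ) + twoAdicFloorAtTwo (padicValNat 2 (W.conductorNorm ℤ))) ≤
      2 * 2 ^ (padicValNat 2 D.modularDegree)

/-- **ES-32B on the slice, in the form the route consumes: `ALMinimalDegreeSelmerTrivialOnSlice`.**  For the crux's `W` (non-CM, surjective
`2`-adic image, odd torsion, odd Tamagawa product, analytic rank `1`): if the optimal modular degree sits ON the Atkin–Lehner floor,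
`v₂(deg) = ω_odd(N) + c(v₂ N)` («AL-minimal degree»; `1 435` of the `3 770` slice curves with `N ≤ 10⁴`, `9 613` of `32 637` with `N ≤ 10⁵`), then `Sel₂(W) ≅ ℤ/2`, hence
`Ш(W)[2] = 0` and `Ш(W)[2^∞] = 0`: the ALGEBRAIC half of `BSD₂(W)` on that sub-slice, leaving `v₂(L'(W,1)/Ω_W R_W) = 0` (the one-door /
Zhang-at-2 analytic statement).  Census: `1 435 / 1 435` (slice, `N ≤ 10⁴`) and `9 613 / 9 613` (slice, `N ≤ 10⁵`, kit j334983 — while `60` slice curves off the floor have `Ш[2] ≅ (ℤ/2)²`), `2 160 / 2 160` resp. `13 064 / 13 064` (all rank-1 `W[2]`-surjective), `842 / 842` resp. `4 677 / 4 677` rank-0 analogues (`v₂(deg) = ω_odd + c − 1 ⟹ Sel₂ = 0`), ENGINE 32S j334662 / j334983.  A consequence of `SelmerAtkinLehnerFloorAtTwo`.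
(RIDER, typer -ty g20: `@[conjecture]` as sketched — the form the route consumes; REF1-AUDIT §235: **SURVIVES** as a COROLLARY of `SelmerAtkinLehnerFloorAtTwo` given
`#W(ℚ)[2] = 1` (-es's glue `TamagawaExponent.Kernel.alMinimal_of_floor`, carried verbatim in the kernel sibling); its conclusion `#Sel₂ ≤ 2` with rank 1 ⇒ `Sel₂ = ℤ/2`, `Ш[2] = 0`
✓ as claimed — the algebraic half of `BSD₂` on that sub-slice, correctly NOT claimed to close 23715.  BC5: 1 435/1 435 (`N ≤ 10⁴`), 9 613/9 613 (`N ≤ 10⁵`, j334983; 60 slice curves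
off the floor have `Ш[2] ≅ (ℤ/2)²`).  REF2 v58-add1 §B: corollary of B♯ (kernel glue), conjecture-grade, NOT in print (the slice × floor coincidence is the cell's); correct
reading of «`Ш(W)[2] = 0` = the algebraic half of `BSD₂(W)` there».) -/
@[conjecture] def ALMinimalDegreeSelmerTrivialOnSlice : Prop :=
  ∀ (W : WeierstrassCurve ℚ) [W.IsElliptic] [W.IsGloballyMinimal] [NeZero (W.conductorNorm ℤ)],
    ¬ W.HasCM → (∀ n : ℕ, W.HasSurjectiveModNGaloisRep ((2 ^ n : ℕ) : ℤ)) → Odd W.torsionOrder → Odd W.tamagawaProduct →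
    W.analyticRank = 1 →
    ∀ (D : ModularParametrizationData W (W.conductorNorm ℤ)),
    (∀ (W'' : WeierstrassCurve ℚ) [W''.IsElliptic] (D'' : ModularParametrizationData W'' (W.conductorNorm ℤ)),
        D''.f = D.f → D.modularDegree ≤ D''.modularDegree) →
    padicValNat 2 D.modularDegree = oddPrimeCount (W.conductorNorm ℤ) + twoAdicFloorAtTwo (padicValNat 2 (W.conductorNorm ℤ)) →
    Nat.card (W.selmerGroup 2) ≤ 2

end Summit.BirchSwinnertonDyer.BirchSwinnertonDyer.Theorems.RankOneAtTwoTamagawaExponent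

end
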